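import Mathlib
import Literature.Combinatorics.Optimization.TracialDesigns

/-!
# Low-degree factors and the nonpositivity of the design value (vocabulary + one statement; nothing asserted)

Companion to `TracialDesigns.lean` (p406031). For an exact extrapolation design `(C, w)` of degree `D`
(`IsExactDesign`), the *design value* of a psd strategy `X_U = A_U A_Uᵀ`, `Y_M = B_M B_Mᵀ` is
`Σ_{c ∈ C} w_c Φ(c)` with `Φ = levelProfile`. When the FACTORS `A`, `B` are low-degree functions of the cut
`U` resp. the matching `M` (Johnson degree `≤ k`, matching degree `≤ k'`, `2(k+k') ≤ D`), `tr(X_U Y_M) =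
‖A_Uᵀ B_M‖_F²` is a sum of squares of pattern-polynomials of degree `≤ k + k'`, `c ↦ Φ(c)` is a polynomial of
degree `≤ D`, and exactness evaluates the design value as MINUS the value at the virtual level `c = 0`, which
is the average over `U` of the product of Grigoriev's symmetric pseudo-matching functionals on `U` and on its
complement — positive semidefinite up to degree `c₀·t` by Grigoriev's theorem
(`Literature.Computability.Complexity.grigoriev2001_mod2Degree_holds`) and SOS duality. Hence the design value
is `≤ 0`. This file only DEFINES the two degree notions and NAMES the statement
`DesignValueNonposLowDegree`; its proof is problem-side work (cell pnp-psdrank, ROUND-3 §2.14–2.15).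

References: Grigoriev 2001 [Grigoriev2001TCS]; Rothvoß 2017, §2 [Rothvoss2017]; Lee–Raghavendra–Steurer 2015,
§5 (matrix-valued low-degree functions) [LeeRaghavendraSteurer2015].
-/

namespace Literature.Combinatorics.Optimization

open Literature.Barriers.PneNP Matrix

/-- `U ↦ A U` has Johnson-degree `≤ k` entrywise: every entry lies in the real span of the containment
indicators `U ↦ 1[A' ⊆ U]` with `|A'| ≤ k`. [cite: LeeRaghavendraSteurer2015, §5] -/
def IsLowDegreeU (n k : ℕ) {r m : ℕ} (A : OddSet n → Matrix (Fin r) (Fin m) ℝ) : Prop :=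
  ∀ i j, (fun U : OddSet n => A U i j) ∈
    Submodule.span ℝ (Set.range fun A' : {A' : Finset (Fin n) // A'.card ≤ k} =>
      fun U : OddSet n => if A'.1 ⊆ U.1 then (1 : ℝ) else 0)

/-- `M ↦ B M` has matching-degree `≤ k` entrywise: every entry lies in the real span of the monomials
`M ↦ x_{B'}(M) = 1[B' ⊆ M]` with `|B'| ≤ k`. [cite: LeeRaghavendraSteurer2015, §5] -/
def IsLowDegreeM (n k : ℕ) {r m : ℕ} (B : PMatch n → Matrix (Fin r) (Fin m) ℝ) : Prop :=
  ∀ i j, (fun M : PMatch n => B M i j) ∈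
    Submodule.span ℝ (Set.range fun B' : {B' : Finset (Sym2 (Fin n)) // B'.card ≤ k} =>
      fun M : PMatch n => if B'.1 ⊆ M.1 then (1 : ℝ) else 0)

/-- **Nonpositivity of the design value on low-degree-factor psd strategies** (statement only): there are
`c₀ > 0` and `n₀` such that for every exact design `(C, w)` of degree `D` on the `t`-cuts (`n₀ ≤ t`) and every
Gram strategy `X_U = A_U A_Uᵀ`, `Y_M = B_M B_Mᵀ` with factor degrees `k, k'`, `2(k+k') ≤ D`, `k + k' ≤ c₀ t`,
one has `Σ_{c ∈ C} w_c · levelProfile(c) ≤ 0`. (Mechanism: exactness at the virtual level + Grigoriev's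
pseudo-matching is PSD; no tightness, variation bound or dimension restriction is needed.)
[cite: Grigoriev2001TCS, Cor. 2 (p. 622)] [cite: Rothvoss2017, §2 (PDF p. 6)] -/
def DesignValueNonposLowDegree : Prop :=
  ∃ c₀ : ℝ, 0 < c₀ ∧ ∃ n₀ : ℕ, ∀ (n t T D : ℕ) (Bv : ℝ) (C : Finset ℕ) (w : ℕ → ℝ),
    IsExactDesign n t T D Bv C w → n₀ ≤ t →
    ∀ (k k' r m : ℕ), 2 * (k + k') ≤ D → ((k + k' : ℕ) : ℝ) ≤ c₀ * t →
    ∀ (A : OddSet n → Matrix (Fin r) (Fin m) ℝ) (B : PMatch n → Matrix (Fin r) (Fin m) ℝ),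
      IsLowDegreeU n k A → IsLowDegreeM n k' B →
      ∑ c ∈ C, w c * levelProfile n t r (fun U => A U * (A U)ᵀ) (fun M => B M * (B M)ᵀ) c ≤ 0

end Literature.Combinatorics.Optimization
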